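import Literature.AlgebraicTopology.Homotopy.CubicalCells
import HarnessLib

/-!
# The grid extension: extending a partial null-homotopy over the unit cubical grid of a chart

Topic `Literature/AlgebraicTopology/Homotopy`; the inductive core of the theorem that weakly
contractible manifolds are contractible (`WeaklyContractibleManifold.lean`), built on the cells
of `CubicalCells.lean` and the box filling of `WhiteheadCWContractible.lean` (Hatcher, *Algebraic
Topology* (2002), Lemma 4.7 / Prop. 0.16: extend over the cells one dimension at a time, the
obstructions lying in the trivial homotopy groups).

* `Cubical.GridData X n`: the data of one chart step in coordinates `ℝⁿ = Fin n → ℝ` — a base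
  point `x₀` at which cubes contract (`WhiteheadCW.CubesContract x₀`), lateness times
  `tau < tau' ≤ 1`, a bottom map `bottom` continuous on `U` (the inverse chart on the chart
  target), and an old homotopy `old` on `D × [0, 1]`, `D ⊆ U`, continuous, starting at `bottom`
  and constant `= x₀` from time `tau` on.
* `Cubical.GridData.ext`: **the grid extension**, defined by induction on the dimension of cells
  (`GridData.Stage d`: a homotopy that is right on all closed cells of dimension `< d` inside `U`;
  `Stage.next`; `GridData.stages`): a cell that is a face of a unit cube inside `D` ("kept")
  keeps `old`; any other cell inside `U` is refilled by `Cubical.Cell.exists_cell_extension` with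
  the graded lateness times `lateTime d` (`lateTime 0 = tau`, `lateTime (n + 1) = tau'`), the
  stage being redefined pointwise through the cell of each point
  (`Stage.nextF p = fill (cellOf p.1) p`), which is consistent because fillings agree with the
  previous stage on the frontier of their cell.
* Result: `ext` is continuous on every closed cell inside `U` (`ext_continuousOn`), starts at
  `bottom` (`ext_zero`), is constant `= x₀` from time `tau'` on (`ext_late`), and equals `old` on
  the unit cubes inside `D` (`ext_of_kept`).

Everything is proved (`[folklore]`); no named facts.

## References

* A. Hatcher, *Algebraic Topology*, CUP (2002), §4.1, Lemma 4.7 and Prop. 0.16. [HatcherAT2002]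
-/

noncomputable section

open Set Metric

namespace Literature.AlgebraicTopology.Homotopy

namespace Cubical

open Cell

variable (X : Type*) [TopologicalSpace X] (n : ℕ)

/-- The data of one chart step, in coordinates: a base point `x₀` at which cubes contract, the
lateness times `tau < tau'`, the bottom map `bottom` (the inverse chart), continuous on `U`
(the chart target), and the old homotopy `old`, defined on `D × [0, 1]` (`D ⊆ U`), starting at
`bottom` and constant `= x₀` from time `tau` on. [folklore] -/
structure GridData where
  /-- the base point -/
  x₀ : X
  /-- cubes contract to the base point (all homotopy groups vanish) -/
  hX : WhiteheadCW.CubesContract x₀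
  /-- the old lateness time -/
  tau : ℝ
  /-- the new lateness time -/
  tau' : ℝ
  tau_pos : 0 < tau
  tau_lt_tau' : tau < tau'
  tau'_le_one : tau' ≤ 1
  /-- where the bottom map is continuous -/
  U : Set (Fin n → ℝ)
  /-- the bottom map -/
  bottom : (Fin n → ℝ) → X
  bottom_cont : ContinuousOn bottom U
  /-- where the old homotopy is defined -/
  D : Set (Fin n → ℝ)
  hDU : D ⊆ U
  /-- the old homotopy -/
  old : (Fin n → ℝ) × ℝ → X
  old_cont : ContinuousOn old (D ×ˢ Icc (0 : ℝ) 1)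
  old_zero : ∀ y ∈ D, old (y, 0) = bottom y
  old_late : ∀ y ∈ D, ∀ t ∈ Icc tau 1, old (y, t) = x₀

variable {X n}

namespace GridData

variable (gd : GridData X n)

/-- A cell is *kept* if it is a face of a lattice cube contained in `D`: there the old homotopy
is kept. [folklore] -/
def Kept (c : Cell n) : Prop := ∃ m : Fin n → ℤ, IsFace c (top m) ∧ cube m ⊆ gd.D

/-- Faces of kept cells are kept. [folklore] -/
theorem Kept.of_isFace {c' c : Cell n} (hc : gd.Kept c) (h : IsFace c' c) : gd.Kept c' := by
  obtain ⟨z, hz, hzD⟩ := hc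
  exact ⟨z, h.trans hz, hzD⟩

/-- A kept cell lies in `D`. [folklore] -/
theorem Kept.ccl_subset {c : Cell n} (hc : gd.Kept c) : ccl c ⊆ gd.D := by
  obtain ⟨z, hz, hzD⟩ := hc
  exact hz.ccl_subset.trans hzD

/-- The graded lateness times: cells of dimension `m` are done by time `lateTime (m + 1)`;
`lateTime 0 = tau`, `lateTime (n + 1) = tau'`. [folklore] -/
def lateTime (d : ℕ) : ℝ := gd.tau + (gd.tau' - gd.tau) * d / (n + 1)

/-- `lateTime 0 = tau`. [folklore] -/
theorem lateTime_zero : gd.lateTime 0 = gd.tau := by simp [lateTime]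

/-- `lateTime (n + 1) = tau'`. [folklore] -/
theorem lateTime_last : gd.lateTime (n + 1) = gd.tau' := by
  simp only [lateTime]; push_cast; field_simp; ring

/-- `lateTime` is monotone. [folklore] -/
theorem lateTime_mono {d d' : ℕ} (h : d ≤ d') : gd.lateTime d ≤ gd.lateTime d' := by
  simp only [lateTime]
  have h1 : (0 : ℝ) < n + 1 := by positivity
  have h2 : (d : ℝ) ≤ d' := by exact_mod_cast h
  have h3 := gd.tau_lt_tau'
  rw [add_le_add_iff_left, div_le_div_iff_of_pos_right h1]
  nlinarith

/-- `lateTime` is strictly increasing. [folklore] -/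
theorem lateTime_lt_succ (d : ℕ) : gd.lateTime d < gd.lateTime (d + 1) := by
  simp only [lateTime]
  have h1 : (0 : ℝ) < n + 1 := by positivity
  have h3 := gd.tau_lt_tau'
  rw [add_lt_add_iff_left, div_lt_div_iff_of_pos_right h1]
  push_cast; nlinarith

/-- `tau ≤ lateTime d`. [folklore] -/
theorem tau_le_lateTime (d : ℕ) : gd.tau ≤ gd.lateTime d := gd.lateTime_zero ▸ gd.lateTime_mono (Nat.zero_le d)

/-- `0 < lateTime d`. [folklore] -/
theorem lateTime_pos (d : ℕ) : 0 < gd.lateTime d := gd.tau_pos.trans_le (gd.tau_le_lateTime d)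

/-- `lateTime d ≤ tau'` for `d ≤ n + 1`. [folklore] -/
theorem lateTime_le_tau' {d : ℕ} (h : d ≤ n + 1) : gd.lateTime d ≤ gd.tau' := gd.lateTime_last ▸ gd.lateTime_mono h

/-- `lateTime d ≤ 1` for `d ≤ n + 1`. [folklore] -/
theorem lateTime_le_one {d : ℕ} (h : d ≤ n + 1) : gd.lateTime d ≤ 1 := (gd.lateTime_le_tau' h).trans gd.tau'_le_one

/-- Stage `d` of the grid extension: a homotopy that is right on all closed cells of dimension
`< d` inside `U` (continuous, starting at `bottom`, constant `= x₀` on `m`-cells from time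
`lateTime (m + 1)` on) and equal to the old homotopy on kept cells. [folklore] -/
structure Stage (d : ℕ) where
  /-- the homotopy (only its values on `U × [0, 1]` matter) -/
  F : (Fin n → ℝ) × ℝ → X
  cont : ∀ c : Cell n, dim c < d → ccl c ⊆ gd.U →
    ContinuousOn F (ccl c ×ˢ Icc (0 : ℝ) 1)
  zero : ∀ c : Cell n, dim c < d → ccl c ⊆ gd.U → ∀ y ∈ ccl c, F (y, 0) = gd.bottom y
  late : ∀ c : Cell n, dim c < d → ccl c ⊆ gd.U → ∀ y ∈ ccl c,
    ∀ t ∈ Icc (gd.lateTime (dim c + 1)) 1, F (y, t) = gd.x₀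
  kept : ∀ y : Fin n → ℝ, gd.Kept (cellOf y) → ∀ t, F (y, t) = gd.old (y, t)

/-- Stage `0`: the old homotopy. [folklore] -/
def stageZero : gd.Stage 0 where
  F := gd.old
  cont _ hc := absurd hc (Nat.not_lt_zero _)
  zero _ hc := absurd hc (Nat.not_lt_zero _)
  late _ hc := absurd hc (Nat.not_lt_zero _)
  kept _ _ _ := rfl

/-- The cells to be filled at stage `d`: dimension `d`, not kept, inside `U`. [folklore] -/
def Todo (d : ℕ) (c : Cell n) : Prop := dim c = d ∧ ¬ gd.Kept c ∧ ccl c ⊆ gd.U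

variable {gd} {d : ℕ}

namespace Stage

/-- The frontier of a cell lies in the union of the closed proper faces. [folklore] -/
theorem diff_subset_iUnion (c : Cell n) :
    ccl c \ opn c ⊆ ⋃ c' : {c' : Cell n // IsFace c' c ∧ dim c' < dim c}, ccl c'.1 := by
  rintro y ⟨hy, hy'⟩
  exact mem_iUnion.2 ⟨⟨cellOf y, mem_ccl_iff_isFace.1 hy, dim_cellOf_lt hy hy'⟩, mem_ccl_cellOf y⟩

/-- On the frontier of a `d`-cell inside `U` a stage-`d` homotopy is continuous. [folklore] -/
theorem continuousOn_diff (s : gd.Stage d) {c : Cell n} (hc : dim c = d) (hcU : ccl c ⊆ gd.U) :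
    ContinuousOn s.F ((ccl c \ opn c) ×ˢ Icc (0 : ℝ) 1) := by
  haveI : Finite {c' : Cell n // IsFace c' c ∧ dim c' < dim c} :=
    ((finite_setOf_isFace c).subset (fun c' (h : IsFace c' c ∧ dim c' < dim c) => h.1)).to_subtype
  refine ContinuousOn.mono ?_ (prod_mono (diff_subset_iUnion c) Subset.rfl)
  rw [iUnion_prod_const]
  refine (locallyFinite_of_finite _).continuousOn_iUnion (fun c' => (isClosed_ccl _).prod isClosed_Icc)
    fun c' => s.cont c'.1 (hc ▸ c'.2.2) (c'.2.1.ccl_subset.trans hcU)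

/-- A point of the frontier of a `d`-cell lies in a closed proper face, of dimension `< d`,
namely the closed cell of its own cell. [folklore] -/
theorem dim_cellOf_lt' {c : Cell n} (hc : dim c = d) {y : Fin n → ℝ} (hy : y ∈ ccl c \ opn c) :
    dim (cellOf y) < d :=
  hc ▸ dim_cellOf_lt hy.1 hy.2

/-- The frontier data of a `d`-cell starts at `bottom`. [folklore] -/
theorem diff_zero (s : gd.Stage d) {c : Cell n} (hc : dim c = d) (hcU : ccl c ⊆ gd.U) :
    ∀ y ∈ ccl c \ opn c, s.F (y, 0) = gd.bottom y := fun y hy =>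
  s.zero (cellOf y) (dim_cellOf_lt' hc hy)
    ((mem_ccl_iff_isFace.1 hy.1).ccl_subset.trans hcU)
    y (mem_ccl_cellOf y)

/-- The frontier data of a `d`-cell is constant `= x₀` from time `lateTime d` on. [folklore] -/
theorem diff_late (s : gd.Stage d) {c : Cell n} (hc : dim c = d) (hcU : ccl c ⊆ gd.U) :
    ∀ y ∈ ccl c \ opn c, ∀ t ∈ Icc (gd.lateTime d) 1, s.F (y, t) = gd.x₀ := fun y hy t ht =>
  s.late (cellOf y) (dim_cellOf_lt' hc hy)
    ((mem_ccl_iff_isFace.1 hy.1).ccl_subset.trans hcU)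
    y (mem_ccl_cellOf y) t
    ⟨(gd.lateTime_mono (Nat.succ_le_of_lt (dim_cellOf_lt' hc hy))).trans ht.1, ht.2⟩

/-- The extension over a cell to be filled exists (`exists_cell_extension`). [folklore] -/
theorem exists_fill (s : gd.Stage d) {c : Cell n} (hc : gd.Todo d c) :
    ∃ G : (Fin n → ℝ) × ℝ → X, ContinuousOn G (ccl c ×ˢ Icc (0 : ℝ) 1) ∧
      (∀ y ∈ ccl c, G (y, 0) = gd.bottom y) ∧
      (∀ y ∈ ccl c \ opn c, ∀ t ∈ Icc (0 : ℝ) 1, G (y, t) = s.F (y, t)) ∧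
      (∀ y ∈ ccl c, ∀ t ∈ Icc (gd.lateTime (d + 1)) 1, G (y, t) = gd.x₀) :=
  have hd : d ≤ n := hc.1 ▸ dim_le c
  exists_cell_extension gd.x₀ gd.hX (gd.lateTime_pos d) (gd.lateTime_lt_succ d)
    (gd.lateTime_le_one (by omega)) c (gd.bottom_cont.mono hc.2.2) (s.continuousOn_diff hc.1 hc.2.2)
    (s.diff_zero hc.1 hc.2.2) (s.diff_late hc.1 hc.2.2)

/-- The homotopy on a cell after stage `d`: the chosen filling on the cells to be filled, the
old stage elsewhere. [folklore] -/
def fill (s : gd.Stage d) (c : Cell n) : (Fin n → ℝ) × ℝ → X := by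
  classical
  exact if hc : gd.Todo d c then (s.exists_fill hc).choose else s.F

/-- Off the cells to be filled, `fill` is the old stage. [folklore] -/
theorem fill_of_not (s : gd.Stage d) {c : Cell n} (hc : ¬ gd.Todo d c) : s.fill c = s.F := by
  simp [fill, hc]

/-- The defining properties of the filling of a cell to be filled. [folklore] -/
theorem fill_spec (s : gd.Stage d) {c : Cell n} (hc : gd.Todo d c) :
    ContinuousOn (s.fill c) (ccl c ×ˢ Icc (0 : ℝ) 1) ∧
      (∀ y ∈ ccl c, s.fill c (y, 0) = gd.bottom y) ∧
      (∀ y ∈ ccl c \ opn c, ∀ t ∈ Icc (0 : ℝ) 1, s.fill c (y, t) = s.F (y, t)) ∧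
      (∀ y ∈ ccl c, ∀ t ∈ Icc (gd.lateTime (d + 1)) 1, s.fill c (y, t) = gd.x₀) := by
  simp only [fill, hc, dif_pos]
  exact (s.exists_fill hc).choose_spec

/-- The homotopy of the next stage: at `y`, the (possibly refilled) homotopy of `y`'s own cell.
[folklore] -/
def nextF (s : gd.Stage d) (p : (Fin n → ℝ) × ℝ) : X := s.fill (cellOf p.1) p

/-- At a point whose cell is not to be filled the next homotopy is the old stage. [folklore] -/
theorem nextF_of_not (s : gd.Stage d) {y : Fin n → ℝ} (hy : ¬ gd.Todo d (cellOf y))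
    (t : ℝ) : s.nextF (y, t) = s.F (y, t) := by
  simp [nextF, s.fill_of_not hy]

/-- On a closed cell to be filled, the next homotopy is the filling of that cell. [folklore] -/
theorem nextF_of_todo (s : gd.Stage d) {c : Cell n} (hc : gd.Todo d c) {y : Fin n → ℝ}
    (hy : y ∈ ccl c) {t : ℝ} (ht : t ∈ Icc (0 : ℝ) 1) : s.nextF (y, t) = s.fill c (y, t) := by
  by_cases hyo : y ∈ opn c
  · simp [nextF, cellOf_eq_of_mem_opn hyo]
  · have hlt : dim (cellOf y) < d := dim_cellOf_lt' hc.1 ⟨hy, hyo⟩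
    have hnot : ¬ gd.Todo d (cellOf y) := fun h => absurd h.1 hlt.ne
    rw [s.nextF_of_not hnot, (s.fill_spec hc).2.2.1 y ⟨hy, hyo⟩ t ht]

/-- On a closed cell none of whose points is to be refilled the next homotopy is the old stage.
[folklore] -/
theorem nextF_of_dim_lt (s : gd.Stage d) {c : Cell n} (hc : dim c < d)
    {y : Fin n → ℝ} (hy : y ∈ ccl c) (t : ℝ) : s.nextF (y, t) = s.F (y, t) := by
  refine s.nextF_of_not (fun h => ?_) t
  have := (mem_ccl_iff_isFace.1 hy).dim_le
  have := h.1; omega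

/-- On a kept closed cell the next homotopy is the old homotopy. [folklore] -/
theorem nextF_of_kept (s : gd.Stage d) {c : Cell n} (hc : gd.Kept c)
    {y : Fin n → ℝ} (hy : y ∈ ccl c) (t : ℝ) : s.nextF (y, t) = gd.old (y, t) := by
  have hk : gd.Kept (cellOf y) := Kept.of_isFace gd hc (mem_ccl_iff_isFace.1 hy)
  rw [s.nextF_of_not (fun h => h.2.1 hk) t, s.kept y hk t]

/-- **The inductive step** of the grid extension. [folklore] -/
def next (s : gd.Stage d) : gd.Stage (d + 1) where
  F := s.nextF
  cont c hcd hcU := by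
    rcases (Nat.lt_succ_iff.1 hcd).lt_or_eq with hlt | heq
    · exact (s.cont c hlt hcU).congr fun p hp => s.nextF_of_dim_lt hlt hp.1 p.2
    · by_cases hk : gd.Kept c
      · exact (gd.old_cont.mono (prod_mono (Kept.ccl_subset gd hk) Subset.rfl)).congr
          fun p hp => s.nextF_of_kept hk hp.1 p.2
      · have htodo : gd.Todo d c := ⟨heq, hk, hcU⟩
        exact (s.fill_spec htodo).1.congr fun p hp => s.nextF_of_todo htodo hp.1 hp.2
  zero c hcd hcU y hy := by
    rcases (Nat.lt_succ_iff.1 hcd).lt_or_eq with hlt | heq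
    · rw [s.nextF_of_dim_lt hlt hy]; exact s.zero c hlt hcU y hy
    · by_cases hk : gd.Kept c
      · rw [s.nextF_of_kept hk hy]; exact gd.old_zero y (Kept.ccl_subset gd hk hy)
      · have htodo : gd.Todo d c := ⟨heq, hk, hcU⟩
        rw [s.nextF_of_todo htodo hy ⟨le_rfl, zero_le_one⟩]
        exact (s.fill_spec htodo).2.1 y hy
  late c hcd hcU y hy t ht := by
    have ht01 : t ∈ Icc (0 : ℝ) 1 := ⟨(gd.lateTime_pos _).le.trans ht.1, ht.2⟩
    rcases (Nat.lt_succ_iff.1 hcd).lt_or_eq with hlt | heq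
    · rw [s.nextF_of_dim_lt hlt hy]; exact s.late c hlt hcU y hy t ht
    · by_cases hk : gd.Kept c
      · rw [s.nextF_of_kept hk hy]
        exact gd.old_late y (Kept.ccl_subset gd hk hy) t ⟨(gd.tau_le_lateTime _).trans ht.1, ht.2⟩
      · have htodo : gd.Todo d c := ⟨heq, hk, hcU⟩
        rw [s.nextF_of_todo htodo hy ht01]
        exact (s.fill_spec htodo).2.2.2 y hy t (heq ▸ ht)
  kept y hk t := by
    rw [s.nextF_of_not (fun h => h.2.1 hk) t, s.kept y hk t]

end Stage

variable (gd)

/-- All stages of the grid extension, by recursion on the dimension. [folklore] -/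
def stages : (d : ℕ) → gd.Stage d
  | 0 => gd.stageZero
  | d + 1 => (stages d).next

/-- **The grid extension**: the homotopy of stage `n + 1` (cells have dimension `≤ n`).
[folklore] -/
def ext : (Fin n → ℝ) × ℝ → X := (gd.stages (n + 1)).F

/-- The grid extension is continuous on every closed cell inside `U`. [folklore] -/
theorem ext_continuousOn {c : Cell n} (hcU : ccl c ⊆ gd.U) :
    ContinuousOn gd.ext (ccl c ×ˢ Icc (0 : ℝ) 1) :=
  (gd.stages (n + 1)).cont c (Nat.lt_succ_of_le (dim_le c)) hcU

/-- The grid extension starts at `bottom` on every closed cell inside `U`. [folklore] -/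
theorem ext_zero {c : Cell n} (hcU : ccl c ⊆ gd.U) {y : Fin n → ℝ} (hy : y ∈ ccl c) :
    gd.ext (y, 0) = gd.bottom y :=
  (gd.stages (n + 1)).zero c (Nat.lt_succ_of_le (dim_le c)) hcU y hy

/-- The grid extension is constant `= x₀` from time `tau'` on, on every closed cell inside `U`.
[folklore] -/
theorem ext_late {c : Cell n} (hcU : ccl c ⊆ gd.U) {y : Fin n → ℝ} (hy : y ∈ ccl c)
    {t : ℝ} (ht : t ∈ Icc gd.tau' 1) : gd.ext (y, t) = gd.x₀ :=
  (gd.stages (n + 1)).late c (Nat.lt_succ_of_le (dim_le c)) hcU y hy t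
    ⟨(gd.lateTime_le_tau' (Nat.succ_le_of_lt (Nat.lt_succ_of_le (dim_le c)))).trans ht.1, ht.2⟩

/-- The grid extension is the old homotopy on kept cubes. [folklore] -/
theorem ext_of_kept {m : Fin n → ℤ} (hm : cube m ⊆ gd.D) {y : Fin n → ℝ} (hy : y ∈ cube m)
    (t : ℝ) : gd.ext (y, t) = gd.old (y, t) :=
  (gd.stages (n + 1)).kept y ⟨m, mem_ccl_iff_isFace.1 hy, hm⟩ t

end GridData

end Cubical

end Literature.AlgebraicTopology.Homotopy

end
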